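import Summits.PneNP.PneNP.Theorems.SymmetryBudgetWindowCanoniserLevelsDefs

/-!
# Window canoniser, V′: levels of the builders; every wire of a shared gate points down

Route `PneNP/SymmetryBudget`, dichotomy `WindowBarrier` (stmt-PneNP-2145) / `NoHiddenOrder` (stmt-PneNP-14781);
continuation of `…WindowCanoniserLevelsDefs.lean`.  The levels of the atom builders, and `WCan.OK a.al (a.args i)`
for the shared atoms (`SKind.args_ok`): each wire of such a gate leads to a gate whose atoms have strictly smaller
atom level.  Replay atoms: `…LevelsReplay.lean`; main atoms: `…LevelsMain.lean`.
-/

-- `Summit.PneNP.PneNP.…` duplicates `PneNP` BY DESIGN (single-problem summit, D-0017 layout).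
set_option linter.dupNamespace false

noncomputable section

namespace Summit.PneNP.PneNP.Theorems

namespace WCan

open Finset Equiv Literature.Computability.Complexity

variable {K r n : ℕ} [NeZero n]

/-! ### Levels of the builders -/

section AlLemmas

variable (L : Lab K n)

/-- `al_aExV`: bookkeeping/simp lemma (al aExV). -/
@[simp] theorem al_aExV (u v : Fin n) : (aExV (K := K) (r := r) u v).al = 0 := rfl
/-- `al_aExO`: bookkeeping/simp lemma (al aExO). -/
@[simp] theorem al_aExO (v : Fin n) (o : Fin r) : (aExO (K := K) v o).al = 1 := rfl
/-- `al_aRLT`: bookkeeping/simp lemma (al aRLT). -/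
@[simp] theorem al_aRLT (rd : Fin (n + 1)) (u w : Fin n) : (aRLT (K := K) (r := r) rd u w).al = 1 + 4 * rd := rfl
/-- `al_aRcge`: bookkeeping/simp lemma (al aRcge). -/
@[simp] theorem al_aRcge (rd : Fin (n + 1)) (u v w : Fin n) : (aRcge (K := K) (r := r) rd u v w).al = 2 + 4 * rd := rfl
/-- `al_aRallb`: bookkeeping/simp lemma (al aRallb). -/
@[simp] theorem al_aRallb (rd : Fin (n + 1)) (u v w : Fin n) : (aRallb (K := K) (r := r) rd u v w).al = 3 + 4 * rd := rfl
/-- `al_aRlex`: bookkeeping/simp lemma (al aRlex). -/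
@[simp] theorem al_aRlex (rd : Fin (n + 1)) (u v : Fin n) : (aRlex (K := K) (r := r) rd u v).al = 4 + 4 * rd := rfl

/-- The base level of label `L`. -/
abbrev lb (L : Lab K n) : ℕ := SH n + L.1.M * BLK n

/-- `al_aW`: bookkeeping/simp lemma (al aW). -/
@[simp] theorem al_aW (it : Fin (T n + 1)) (v : Fin n) : (aW (r := r) L it v).al = lb L + it * RS n := rfl
/-- `al_aLT`: bookkeeping/simp lemma (al aLT). -/
@[simp] theorem al_aLT (it : Fin (T n + 1)) (u w : Fin n) : (aLT (r := r) L it u w).al = lb L + it * RS n := rfl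
/-- `al_aC`: bookkeeping/simp lemma (al aC). -/
@[simp] theorem al_aC (it : Fin (T n + 1)) (v : Fin n) : (aC (r := r) L it v).al = lb L + it * RS n := rfl
/-- `al_aARR`: bookkeeping/simp lemma (al aARR). -/
@[simp] theorem al_aARR (it : Fin (T n + 1)) (z : Fin n) : (aARR (r := r) L it z).al = lb L + it * RS n := rfl
/-- `al_aDEAD`: bookkeeping/simp lemma (al aDEAD). -/
@[simp] theorem al_aDEAD (it : Fin (T n + 1)) (z : Fin n) : (aDEAD (r := r) L it z).al = lb L + it * RS n := rfl
/-- `al_aFrz`: bookkeeping/simp lemma (al aFrz). -/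
@[simp] theorem al_aFrz (it : Fin (T n + 1)) (z : Fin n) : (aFrz (r := r) L it z).al = lb L + (it * RS n + 2) := rfl
/-- `al_aNow`: bookkeeping/simp lemma (al aNow). -/
@[simp] theorem al_aNow (it : Fin (T n + 1)) (z : Fin n) : (aNow (r := r) L it z).al = lb L + (it * RS n + 1) := rfl
/-- `al_aCnt1`: bookkeeping/simp lemma (al aCnt1). -/
@[simp] theorem al_aCnt1 (it : Fin (T n + 1)) (z : Fin n) : (aCnt1 (r := r) L it z).al = lb L + (it * RS n + 1) := rfl
/-- `al_aSw`: bookkeeping/simp lemma (al aSw). -/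
@[simp] theorem al_aSw (it : Fin (T n + 1)) (v w : Fin n) : (aSw (r := r) L it v w).al = lb L + (it * RS n + 1) := rfl
/-- `al_aReach`: bookkeeping/simp lemma (al aReach). -/
@[simp] theorem al_aReach (it : Fin (T n + 1)) (s : Fin (n + 1)) (u y : Fin n) :
    (aReach (r := r) L it s u y).al = lb L + (it * RS n + 2 + s) := rfl
/-- `al_aConn`: bookkeeping/simp lemma (al aConn). -/
@[simp] theorem al_aConn (it : Fin (T n + 1)) (z : Fin n) : (aConn (r := r) L it z).al = lb L + (it * RS n + (n + 3)) := rfl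
/-- `al_aSzGE`: bookkeeping/simp lemma (al aSzGE). -/
@[simp] theorem al_aSzGE (it : Fin (T n + 1)) (v w : Fin n) : (aSzGE (r := r) L it v w).al = lb L + (it * RS n + 1) := rfl
/-- `al_aBig`: bookkeeping/simp lemma (al aBig). -/
@[simp] theorem al_aBig (it : Fin (T n + 1)) (v : Fin n) : (aBig (r := r) L it v).al = lb L + (it * RS n + 1) := rfl
/-- `al_aBmc`: bookkeeping/simp lemma (al aBmc). -/
@[simp] theorem al_aBmc (it : Fin (T n + 1)) (v : Fin n) : (aBmc (r := r) L it v).al = lb L + (it * RS n + 2) := rfl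
/-- `al_aSel`: bookkeeping/simp lemma (al aSel). -/
@[simp] theorem al_aSel (it : Fin (T n + 1)) (v : Fin n) : (aSel (r := r) L it v).al = lb L + (it * RS n + 3) := rfl
/-- `al_aHasSel`: bookkeeping/simp lemma (al aHasSel). -/
@[simp] theorem al_aHasSel (it : Fin (T n + 1)) (z : Fin n) : (aHasSel (r := r) L it z).al = lb L + (it * RS n + 4) := rfl
/-- `al_aPok`: bookkeeping/simp lemma (al aPok). -/
@[simp] theorem al_aPok (it : Fin (T n + 1)) (z : Fin n) : (aPok (r := r) L it z).al = lb L + (it * RS n + (n + 3)) := rfl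
/-- `al_aNWs`: bookkeeping/simp lemma (al aNWs). -/
@[simp] theorem al_aNWs (it : Fin (T n + 1)) (v : Fin n) : (aNWs (r := r) L it v).al = lb L + (it * RS n + (n + 3)) := rfl
/-- `al_aFLT`: bookkeeping/simp lemma (al aFLT). -/
@[simp] theorem al_aFLT (it : Fin (T n + 1)) (rd : Fin (n + 1)) (u w : Fin n) :
    (aFLT (r := r) L it rd u w).al = lb L + (it * RS n + (4 + 4 * rd)) := rfl
/-- `al_aFcge`: bookkeeping/simp lemma (al aFcge). -/
@[simp] theorem al_aFcge (it : Fin (T n + 1)) (rd : Fin (n + 1)) (u v w : Fin n) :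
    (aFcge (r := r) L it rd u v w).al = lb L + (it * RS n + (5 + 4 * rd)) := rfl
/-- `al_aFallb`: bookkeeping/simp lemma (al aFallb). -/
@[simp] theorem al_aFallb (it : Fin (T n + 1)) (rd : Fin (n + 1)) (u v w : Fin n) :
    (aFallb (r := r) L it rd u v w).al = lb L + (it * RS n + (6 + 4 * rd)) := rfl
/-- `al_aFlex`: bookkeeping/simp lemma (al aFlex). -/
@[simp] theorem al_aFlex (it : Fin (T n + 1)) (rd : Fin (n + 1)) (u v : Fin n) :
    (aFlex (r := r) L it rd u v).al = lb L + (it * RS n + (7 + 4 * rd)) := rfl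

/-- `al_aRkGE`: bookkeeping/simp lemma (al aRkGE). -/
@[simp] theorem al_aRkGE (w : Fin n) (j : Fin (n + 1)) : (aRkGE (r := r) L w j).al = lb L + (T n + 1) * RS n := rfl
/-- `al_aMtch`: bookkeeping/simp lemma (al aMtch). -/
@[simp] theorem al_aMtch (ch : Ch n) (z : Fin n) (it : Fin (T n + 1)) : (aMtch (r := r) L ch z it).al = lb L + (T n + 1) * RS n := by
  cases ch <;> rfl
/-- `al_aThru`: bookkeeping/simp lemma (al aThru). -/
@[simp] theorem al_aThru (ch : Ch n) (z : Fin n) : (aThru (r := r) L ch z).al = lb L + ((T n + 1) * RS n + 1) := by cases ch <;> rfl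
/-- `al_aCert`: bookkeeping/simp lemma (al aCert). -/
@[simp] theorem al_aCert (ch : Ch n) (z : Fin n) : (aCert (r := r) L ch z).al = lb L + ((T n + 1) * RS n + 2) := by cases ch <;> rfl
/-- `al_aPcand`: bookkeeping/simp lemma (al aPcand). -/
@[simp] theorem al_aPcand (κ : Fin n × Fin (n + 1)) (p w : Fin n) : (aPcand (r := r) L κ p w).al = lb L + (T n + 1) * RS n := rfl
/-- `al_aLcrk`: bookkeeping/simp lemma (al aLcrk). -/
@[simp] theorem al_aLcrk (κ : Fin n × Fin (n + 1)) (p j : Fin n) : (aLcrk (r := r) L κ p j).al = lb L + ((T n + 1) * RS n + 1) := rfl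
/-- `al_aPfx`: bookkeeping/simp lemma (al aPfx). -/
@[simp] theorem al_aPfx (κ κ' : Fin n × Fin (n + 1)) (t : Fin (NB r n + 1)) : (aPfx L κ κ' t).al = lb L + ((T n + 1) * RS n + 2) := rfl
/-- `al_aLexLE`: bookkeeping/simp lemma (al aLexLE). -/
@[simp] theorem al_aLexLE (κ κ' : Fin n × Fin (n + 1)) : (aLexLE (r := r) L κ κ').al = lb L + ((T n + 1) * RS n + 3) := rfl
/-- `al_aBest`: bookkeeping/simp lemma (al aBest). -/
@[simp] theorem al_aBest (κ : Fin n × Fin (n + 1)) : (aBest (r := r) L κ).al = lb L + ((T n + 1) * RS n + 4) := rfl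
/-- `al_aIvbit`: bookkeeping/simp lemma (al aIvbit). -/
@[simp] theorem al_aIvbit (z : Fin n) (b : Fin (NB r n)) : (aIvbit L z b).al = lb L + ((T n + 1) * RS n + 5) := rfl
/-- `al_aInonbot`: bookkeeping/simp lemma (al aInonbot). -/
@[simp] theorem al_aInonbot (z : Fin n) : (aInonbot (r := r) L z).al = lb L + ((T n + 1) * RS n + 3) := rfl
/-- `al_aIsP`: bookkeeping/simp lemma (al aIsP). -/
@[simp] theorem al_aIsP (u : Fin n) (U' : Finset (Fin n)) : (aIsP (r := r) L u U').al = lb L + (T n + 1) * RS n := rfl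
/-- `al_aPcov`: bookkeeping/simp lemma (al aPcov). -/
@[simp] theorem al_aPcov (u : Fin n) : (aPcov (r := r) L u).al = lb L + ((T n + 1) * RS n + 3) := rfl
/-- `al_aPnonbot`: bookkeeping/simp lemma (al aPnonbot). -/
@[simp] theorem al_aPnonbot (z : Fin n) : (aPnonbot (r := r) L z).al = lb L + ((T n + 1) * RS n + 4) := rfl
/-- `al_aPbit`: bookkeeping/simp lemma (al aPbit). -/
@[simp] theorem al_aPbit (u : Fin n) (i : Fin (NBp r n)) : (aPbit L u i).al = lb L + ((T n + 1) * RS n + 1) := rfl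
/-- `al_aRkInGE`: bookkeeping/simp lemma (al aRkInGE). -/
@[simp] theorem al_aRkInGE (U' : Finset (Fin n)) (w : Fin n) (j : Fin (n + 1)) : (aRkInGE (r := r) L U' w j).al = lb L + (T n + 1) * RS n := rfl
/-- `al_aPcP`: bookkeeping/simp lemma (al aPcP). -/
@[simp] theorem al_aPcP (U' : Finset (Fin n)) (p w : Fin n) : (aPcP (r := r) L U' p w).al = lb L + ((T n + 1) * RS n + 1) := rfl
/-- `al_aPpc`: bookkeeping/simp lemma (al aPpc). -/
@[simp] theorem al_aPpc (u p w : Fin n) : (aPpc (r := r) L u p w).al = lb L + ((T n + 1) * RS n + 2) := rfl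
/-- `al_aPcrk`: bookkeeping/simp lemma (al aPcrk). -/
@[simp] theorem al_aPcrk (u p j : Fin n) : (aPcrk (r := r) L u p j).al = lb L + ((T n + 1) * RS n + 3) := rfl
/-- `al_aPpfx`: bookkeeping/simp lemma (al aPpfx). -/
@[simp] theorem al_aPpfx (u u' : Fin n) (t : Fin (NBp r n + 1)) : (aPpfx L u u' t).al = lb L + ((T n + 1) * RS n + 4) := rfl
/-- `al_aPlexLT`: bookkeeping/simp lemma (al aPlexLT). -/
@[simp] theorem al_aPlexLT (u u' : Fin n) : (aPlexLT (r := r) L u u').al = lb L + ((T n + 1) * RS n + 5) := rfl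
/-- `al_aPlexEQ`: bookkeeping/simp lemma (al aPlexEQ). -/
@[simp] theorem al_aPlexEQ (u u' : Fin n) : (aPlexEQ (r := r) L u u').al = lb L + ((T n + 1) * RS n + 4) := rfl
/-- `al_aPstGE`: bookkeeping/simp lemma (al aPstGE). -/
@[simp] theorem al_aPstGE (u : Fin n) (t : Fin (n + 1)) : (aPstGE (r := r) L u t).al = lb L + ((T n + 1) * RS n + 6) := rfl
/-- `al_aPbcGE`: bookkeeping/simp lemma (al aPbcGE). -/
@[simp] theorem al_aPbcGE (u : Fin n) (t : Fin (n + 1)) : (aPbcGE (r := r) L u t).al = lb L + ((T n + 1) * RS n + 5) := rfl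
/-- `al_aPat`: bookkeeping/simp lemma (al aPat). -/
@[simp] theorem al_aPat (p u i o : Fin n) : (aPat (r := r) L p u i o).al = lb L + ((T n + 1) * RS n + 7) := rfl
/-- `al_aOff`: bookkeeping/simp lemma (al aOff). -/
@[simp] theorem al_aOff (p u o : Fin n) : (aOff (r := r) L p u o).al = lb L + ((T n + 1) * RS n + 8) := rfl
/-- `al_aBlkI`: bookkeeping/simp lemma (al aBlkI). -/
@[simp] theorem al_aBlkI (p u i : Fin n) : (aBlkI (r := r) L p u i).al = lb L + ((T n + 1) * RS n + 8) := rfl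
/-- `al_aSamePart`: bookkeeping/simp lemma (al aSamePart). -/
@[simp] theorem al_aSamePart (p q z : Fin n) : (aSamePart (r := r) L p q z).al = lb L + ((T n + 1) * RS n + 9) := rfl
/-- `al_aSpc`: bookkeeping/simp lemma (al aSpc). -/
@[simp] theorem al_aSpc (p w : Fin n) : (aSpc (r := r) L p w).al = lb L + ((T n + 1) * RS n + 9) := rfl
/-- `al_aSvadj`: bookkeeping/simp lemma (al aSvadj). -/
@[simp] theorem al_aSvadj (p q z : Fin n) : (aSvadj (r := r) L p q z).al = lb L + ((T n + 1) * RS n + 10) := rfl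
/-- `al_aSvext`: bookkeeping/simp lemma (al aSvext). -/
@[simp] theorem al_aSvext (p : Fin n) (o : Fin r) (z : Fin n) : (aSvext L p o z).al = lb L + ((T n + 1) * RS n + 9) := rfl
/-- `al_aSvcrk`: bookkeeping/simp lemma (al aSvcrk). -/
@[simp] theorem al_aSvcrk (p j z : Fin n) : (aSvcrk (r := r) L p j z).al = lb L + ((T n + 1) * RS n + 10) := rfl
/-- `al_aVbit`: bookkeeping/simp lemma (al aVbit). -/
@[simp] theorem al_aVbit (z : Fin n) (b : Fin (NB r n)) : (aVbit L z b).al = lb L + ((T n + 1) * RS n + 11) := rfl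

omit [NeZero n] in
/-- `RS n = 4n + 8`. -/
theorem RS_eq : RS n = 4 * n + 8 := rfl

omit [NeZero n] in
/-- The main computation dominates every replay level of the same label. -/
theorem it_RS_lt_main (it : Fin (T n + 1)) (e : ℕ) (he : e < RS n) (X : ℕ) :
    lb L + (it * RS n + e) < lb L + ((T n + 1) * RS n + X) := by
  have h1 : (it : ℕ) * RS n ≤ T n * RS n := Nat.mul_le_mul_right _ (Nat.lt_succ_iff.1 it.2)
  have h2 : T n * RS n + RS n = (T n + 1) * RS n := by ring
  omega

end AlLemmas

/-! ### Shared atoms -/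

/-- **Every wire of a shared atom points down.** -/
theorem SKind.args_ok (k : SKind) (P : Prm r n) (i : Fin (k.fn n).1) :
    OK (Atom.sh k P : Atom K r n).al (k.args (K := K) P i) := by
  have hal : ∀ k' : SKind, (Atom.sh k' P : Atom K r n).al = k'.al n P := fun _ => rfl
  cases k with
  | exV => simp only [SKind.args]; split_ifs <;> exact ok_inl _
  | exO =>
    rw [hal]
    simp only [SKind.args, SKind.al]
    cases P.o1 with
    | none => exact ok_wA (by simp)
    | some o => dsimp only; split_ifs <;> exact ok_inl _
  | rLT =>
    rw [hal]
    simp only [SKind.args, SKind.al]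
    rcases hrd : P.rd with ⟨_ | t, ht⟩
    · exact ok_wA (by simp)
    · refine ok_w2_n2or ?_ (by omega)
      simp only [List.mem_cons, List.not_mem_nil, or_false, forall_eq_or_imp, forall_eq]
      refine ⟨n1ok_litN1 (by simp) (by omega), n1ok_n1and ?_ (by omega)⟩
      simp only [List.mem_cons, List.not_mem_nil, or_false, forall_eq_or_imp, forall_eq, al_aRLT, al_aRlex]
      omega
  | rcge =>
    rw [hal]
    simp only [SKind.args, SKind.al]
    refine ok_append (fun w' => ok_w1_n1and ?_ (by omega)) (fun w' => ok_w1_n1or ?_ (by omega)) i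
    · simp only [List.mem_cons, List.not_mem_nil, or_false, forall_eq_or_imp, forall_eq, al_adjLit, al_aRLT]; omega
    · simp only [List.mem_cons, List.not_mem_nil, or_false, forall_eq_or_imp, forall_eq, al_nadjLit, al_aRLT]; omega
  | rallb =>
    rw [hal]
    simp only [SKind.args, SKind.al]
    refine ok_w2_n2or ?_ (by omega)
    simp only [List.mem_cons, List.not_mem_nil, or_false, forall_eq_or_imp, forall_eq]
    refine ⟨n1ok_litN1 (by simp) (by omega), n1ok_n1and ?_ (by omega)⟩
    simp only [List.mem_cons, List.not_mem_nil, or_false, forall_eq_or_imp, forall_eq, al_aRcge]; omega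
  | rlex =>
    rw [hal]
    simp only [SKind.args, SKind.al]
    refine ok_w1_n1and ?_ (by omega)
    simp only [List.mem_cons, List.not_mem_nil, or_false, forall_eq_or_imp, forall_eq, al_aRcge, al_aRallb]; omega

end WCan

end Summit.PneNP.PneNP.Theorems

end
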